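import Literature.NumberTheory.EllipticCurves.ComplexMultiplicationLocalFactorsAux
import Literature.NumberTheory.EllipticCurves.TwoIsogenyPointCount
import Literature.NumberTheory.EllipticCurves.CongruentNumberCurveMinimalAtTwo
import Literature.NumberTheory.EllipticCurves.IsogenyCompProofs
import HarnessLib

/-!
# Equal `L`-functions across the CM isogeny class `j = 287496 ~ j = 1728` and all its twists

Sibling file of `Literature.NumberTheory.EllipticCurves.ComplexMultiplication` (D-0014 append
protocol; everything here is proved). The curve `E : y² = x³ - 6x² + x` (`j = 287496 = 66³`, CM
by the order `ℤ[2i]` of conductor `2` in `ℚ(i)`) is `2`-isogenous over `ℚ` to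
`y² = x³ + 3x² + 2x ≅ y² = x³ - x` (`j = 1728`, CM by `ℤ[i]`) (Silverman, *AEC*, III.4.5; the
tree's `isIsogenous_cm16`); the same holds for every quadratic twist. Knapp's Theorem 11.67
(*Elliptic Curves*, p. 281: isogenous curves over `ℚ` have the same `L`-function; vendored as the
named fact `Literature.NumberTheory.EllipticCurves.LFunction_eq_of_isIsogenous`) is proved in print via Tate modules / Néron
models at the bad primes. **This file proves its instance for this isogeny class and all its
quadratic twists directly**, prime by prime, for Mathlib's `WeierstrassCurve.LFunction`:

`L(E_d, s) = L(E'_d, s)` for `E_d = [0, -6d, 0, d², 0]`, `E'_d = [0, 3d, 0, 2d², 0]`, every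
squarefree integer `d ≠ 0` (`WeierstrassCurve.LFunction_cm16_eq`).

* At `p ∣ 2d` both curves have additive reduction, so both local factors are `1`
  (`LocalEulerFactorModel.hasAdditiveReductionAt_map_of_Δ_eq`: `Δ(E_d) = 2⁹d⁶`,
  `c₄(E_d) = 528d²`, so `ord_p(Δ) ∈ {6, 9, 15} ∌ 12ℤ` and `ord_p(j) ≥ 0`; for `E'_d`,
  `Δ = 64d⁶` has `ord₂ = 12` when `d` is even, and we use instead that
  `E'_d = ⟨1, d, 0, 0⟩ • (y² = x³ - d²x)` is the congruent number curve, whose additive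
  reduction at `p ∣ 2d` is the tree's `hasAdditiveReductionAt_congruentNumberCurve`, proved there
  by a `2`-adic minimality argument).
* At `p ∤ 2d` both models have good reduction (`p ∤ Δ`), the local factors are
  `1 - a_pT + pT²` with `a_p` counted on the reductions of the models themselves
  (`localPolynomial_map_of_not_dvd`), and `#E_d(𝔽_p) = #E'_d(𝔽_p)` because the reductions are
  `2`-isogenous over `𝔽_p` (`natCard_point_twoTorsionNF_eq`: the explicit `2`-isogeny and the
  prime-degree torsor lemma; `E'_d ≅ ⟨2,0,0,0⟩ • [0, 12d, 0, 32d², 0]` over `𝔽_p`, `p` odd) —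
  this is exactly Knapp's sketch of proof ("for `p` prime to `ΔΔ'`, `#E_p = #E'_p`", (11.89)).

So for this class the hypothesis `LFunction_eq_of_isIsogenous` of the CM reductions in
`ComplexMultiplication*Proofs` is discharged (`isIsogenous_and_LFunction_eq_cm16`).

## References

* A. W. Knapp, *Elliptic Curves*, Math. Notes 40, Princeton 1992, Thm. 11.67 with its sketch of
  proof, (10.9)–(10.10) (PDF pp. 222, 281–282). [cite: Knapp1993]
* J. H. Silverman, *The Arithmetic of Elliptic Curves*, 2nd ed. (2009), III.4 Example 4.5,
  VII.5 Prop. 5.1, §C.16, Exercise 5.4(a). [cite: SilvermanAEC2009]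
* J. H. Silverman, *Advanced Topics in the Arithmetic of Elliptic Curves* (1994), App. A §3
  (table of CM curves over `ℚ`: `D = -4`, `f = 2`, `j = 287496 = 2⁴·3³·11³`… `= 66³`).
  [cite: SilvermanAdvancedTopics1994, App. A §3]
-/

noncomputable section

open scoped Classical

open IsDedekindDomain NumberField Rat.HeightOneSpectrum Polynomial

namespace WeierstrassCurve

/-! ## The models -/

/-- The twist family of `y² = x³ - 6x² + x` (`j = 287496`): `E_d = [0, -6d, 0, d², 0]` over `ℤ`.
Silverman, *Advanced Topics*, App. A §3 (`D = -4`, `f = 2`). [folklore] -/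
def cm16Model (d : ℤ) : WeierstrassCurve ℤ :=
  ⟨0, -6 * d, 0, d ^ 2, 0⟩

/-- The twist family of `y² = x³ + 3x² + 2x ≅ y² = x³ - x` (`j = 1728`), the `2`-isogenous
partner of `cm16Model d` (the codomain `[0, 12d, 0, 32d², 0]` of Silverman's `2`-isogeny,
rescaled by `u = 2`): `E'_d = [0, 3d, 0, 2d², 0]`. [folklore] -/
def cm16Codomain (d : ℤ) : WeierstrassCurve ℤ :=
  ⟨0, 3 * d, 0, 2 * d ^ 2, 0⟩

section Invariants

variable (d : ℤ)

/-- `E_d` base-changed along `ℤ → R`. [folklore] -/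
@[simp] theorem map_cm16Model {R : Type*} [CommRing R] (f : ℤ →+* R) :
    (cm16Model d).map f = ⟨0, -6 * (d : R), 0, (d : R) ^ 2, 0⟩ := by
  simp [cm16Model, WeierstrassCurve.map]

/-- `E'_d` base-changed along `ℤ → R`. [folklore] -/
@[simp] theorem map_cm16Codomain {R : Type*} [CommRing R] (f : ℤ →+* R) :
    (cm16Codomain d).map f = ⟨0, 3 * (d : R), 0, 2 * (d : R) ^ 2, 0⟩ := by
  simp [cm16Codomain, WeierstrassCurve.map]

/-- `Δ(E_d) = 2⁹ d⁶`. [folklore] -/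
theorem cm16Model_Δ : (cm16Model d).Δ = 2 ^ 9 * d ^ 6 := by
  simp only [cm16Model, Δ, b₂, b₄, b₆, b₈]; ring

/-- `c₄(E_d) = 528 d²`. [folklore] -/
theorem cm16Model_c₄ : (cm16Model d).c₄ = 528 * d ^ 2 := by
  simp only [cm16Model, c₄, b₂, b₄]; ring

/-- `Δ(E'_d) = 2⁶ d⁶`. [folklore] -/
theorem cm16Codomain_Δ : (cm16Codomain d).Δ = 2 ^ 6 * d ^ 6 := by
  simp only [cm16Codomain, Δ, b₂, b₄, b₆, b₈]; ring

/-- `E'_d = ⟨1, d, 0, 0⟩ • (y² = x³ - d²x)`: the partner is the congruent number curve for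
`|d|` (translate `x ↦ x - d` in `x(x + d)(x + 2d)`). [folklore] -/
theorem cm16Codomain_eq_smul_congruentNumberCurve :
    (cm16Codomain d).map (Int.castRingHom ℚ) =
      (⟨1, (d : ℚ), 0, 0⟩ : VariableChange ℚ) • Literature.NumberTheory.EllipticCurves.congruentNumberCurve d.natAbs := by
  rw [map_cm16Codomain]
  ext
  · simp [variableChange_a₁]
  · simp [variableChange_a₂]
  · simp [variableChange_a₃]
  · simp [variableChange_a₄, Nat.cast_natAbs, sq_abs]; ring
  · simp [variableChange_a₆, Nat.cast_natAbs, sq_abs]; ring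

end Invariants

/-! ## The additive places `p ∣ 2d` -/

section Additive

variable (v : HeightOneSpectrum (𝓞 ℚ)) {d : ℤ}

/-- **`E_d` has additive reduction at every `p ∣ 2d`** (`d` squarefree): `ord_p(Δ) = ord_p(2⁹d⁶)
∈ {6, 9, 15}` is not a multiple of `12` and `3 ord_p(c₄) = 3 ord_p(528 d²) ≥ ord_p(Δ)`.
[cite: SilvermanAEC2009, VII.5 Prop. 5.1(c)] -/
theorem hasAdditiveReductionAt_cm16Model (hsq : Squarefree d)
    (hv : (natGenerator v : ℤ) ∣ 2 * d) :
    ((cm16Model d).map (Int.castRingHom ℚ)).HasAdditiveReductionAt v := by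
  have hpZ := Rat.prime_natGenerator_int v
  by_cases hpd : (natGenerator v : ℤ) ∣ d
  · obtain ⟨d₀, rfl, hd₀⟩ := Int.exists_eq_mul_not_dvd_of_squarefree hpZ hsq hpd
    by_cases hp2 : natGenerator v = 2
    · -- `p = 2 ∣ d`: `Δ = 2¹⁵ d₀⁶`, `c₄ = 2⁶ · 33 d₀²`
      have hm : ¬ ((natGenerator v : ℕ) : ℤ) ∣ d₀ ^ 6 := fun h ↦ hd₀ (hpZ.dvd_of_dvd_pow h)
      refine hasAdditiveReductionAt_map_of_data v _ (n := 15) (e := 6) (m := d₀ ^ 6)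
        (k := 33 * d₀ ^ 2) ?_ hm (by decide) ?_ (by norm_num)
      · rw [cm16Model_Δ, hp2]; push_cast; ring
      · rw [cm16Model_c₄, hp2]; push_cast; ring
    · -- odd `p ∣ d`: `Δ = p⁶ (2⁹ d₀⁶)`, `c₄ = p² (528 d₀²)`
      have hm : ¬ ((natGenerator v : ℕ) : ℤ) ∣ 2 ^ 9 * d₀ ^ 6 := fun h ↦ by
        rcases hpZ.dvd_or_dvd h with h | h
        · exact Rat.not_natGenerator_dvd_of_ne v Nat.prime_two hp2 (hpZ.dvd_of_dvd_pow h)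
        · exact hd₀ (hpZ.dvd_of_dvd_pow h)
      refine hasAdditiveReductionAt_map_of_data v _ (n := 6) (e := 2) (m := 2 ^ 9 * d₀ ^ 6)
        (k := 528 * d₀ ^ 2) ?_ hm (by decide) ?_ (by norm_num)
      · rw [cm16Model_Δ]; ring
      · rw [cm16Model_c₄]; ring
  · -- `p ∤ d`, so `p = 2` and `d` is odd: `Δ = 2⁹ d⁶`, `c₄ = 2⁴ · 33 d²`
    have hp2 : natGenerator v = 2 := by
      rcases hpZ.dvd_or_dvd hv with h | h
      · exact Rat.natGenerator_eq_of_dvd v Nat.prime_two h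
      · exact absurd h hpd
    have hm : ¬ ((natGenerator v : ℕ) : ℤ) ∣ d ^ 6 := fun h ↦ hpd (hpZ.dvd_of_dvd_pow h)
    refine hasAdditiveReductionAt_map_of_data v _ (n := 9) (e := 4) (m := d ^ 6)
      (k := 33 * d ^ 2) ?_ hm (by decide) ?_ (by norm_num)
    · rw [cm16Model_Δ, hp2]; push_cast; ring
    · rw [cm16Model_c₄, hp2]; push_cast; ring

/-- **`E'_d` has additive reduction at every `p ∣ 2d`** (`d ≠ 0` squarefree): it is the
congruent number curve `y² = x³ - d²x` up to `x ↦ x - d`, for which this is the tree's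
`hasAdditiveReductionAt_congruentNumberCurve` (including the `2`-adic minimality argument for
even `d`, where `ord₂(Δ) = 12`). [cite: SilvermanAEC2009, VII.5 Prop. 5.1(c)] -/
theorem hasAdditiveReductionAt_cm16Codomain (hd : d ≠ 0) (hsq : Squarefree d)
    (hv : (natGenerator v : ℤ) ∣ 2 * d) :
    ((cm16Codomain d).map (Int.castRingHom ℚ)).HasAdditiveReductionAt v := by
  haveI : (Literature.NumberTheory.EllipticCurves.congruentNumberCurve d.natAbs).IsElliptic := by
    refine ⟨isUnit_iff_ne_zero.mpr ?_⟩
    rw [Literature.NumberTheory.EllipticCurves.congruentNumberCurve_Δ]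
    have : (d.natAbs : ℚ) ≠ 0 := by exact_mod_cast (Int.natAbs_ne_zero.mpr hd)
    exact mul_ne_zero (by norm_num) (pow_ne_zero _ this)
  rw [cm16Codomain_eq_smul_congruentNumberCurve]
  refine (hasAdditiveReductionAt_smul_iff_holds v _ _).mpr
    (Literature.NumberTheory.EllipticCurves.hasAdditiveReductionAt_congruentNumberCurve v (Int.squarefree_natAbs.mpr hsq) ?_)
  have : (natGenerator v : ℤ) ∣ ((2 * d.natAbs : ℕ) : ℤ) := by
    rw [Nat.cast_mul, Nat.cast_ofNat, Int.natCast_natAbs]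
    exact hv.trans (mul_dvd_mul_left 2 (self_dvd_abs d))
  exact_mod_cast this

end Additive

/-! ## The good places `p ∤ 2d`: equal point counts of the reductions -/

section Good

variable {p : ℕ} [Fact p.Prime] {d : ℤ}

/-- Over `𝔽_p` (`p ∤ 2d`) the reduction of `E_d` is elliptic. [folklore] -/
theorem isElliptic_cm16Model_zmod (hpd : ¬ (p : ℤ) ∣ 2 * d) :
    ((cm16Model d).map (Int.castRingHom (ZMod p))).IsElliptic := by
  refine ⟨isUnit_iff_ne_zero.mpr ?_⟩
  rw [map_Δ, cm16Model_Δ]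
  simp only [map_mul, map_pow, eq_intCast, Int.cast_ofNat]
  have h2 : (2 : ZMod p) ≠ 0 := by
    intro h
    apply hpd
    have : (p : ℤ) ∣ 2 := by
      have := (ZMod.intCast_zmod_eq_zero_iff_dvd 2 p).mp (by exact_mod_cast h)
      exact_mod_cast this
    exact this.trans (dvd_mul_right 2 d)
  have hd : ((d : ℤ) : ZMod p) ≠ 0 := fun h ↦
    hpd (((ZMod.intCast_zmod_eq_zero_iff_dvd d p).mp h).mul_left 2)
  exact mul_ne_zero (pow_ne_zero _ h2) (pow_ne_zero _ hd)

/-- **`#E_d(𝔽_p) = #E'_d(𝔽_p)` for `p ∤ 2d`**: the reductions are `2`-isogenous over `𝔽_p`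
(Silverman III.4.5), hence have equally many points (`natCard_point_twoTorsionNF_eq`, the
prime-degree torsor lemma; `E'_d = ⟨2, 0, 0, 0⟩ • [0, 12d, 0, 32d², 0]` over `𝔽_p`). This is
the input "`#E_p = #E'_p`" of Knapp's proof of Thm. 11.67.
[cite: Knapp1993, proof of Thm. 11.67, (11.89) (PDF p. 282)] -/
theorem natCard_point_cm16_zmod_eq (hpd : ¬ (p : ℤ) ∣ 2 * d) :
    Nat.card ((cm16Model d).map (Int.castRingHom (ZMod p))).toAffine.Point =
      Nat.card ((cm16Codomain d).map (Int.castRingHom (ZMod p))).toAffine.Point := by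
  haveI := isElliptic_cm16Model_zmod hpd
  have h2 : (2 : ZMod p) ≠ 0 := by
    intro h
    apply hpd
    have : (p : ℤ) ∣ 2 := by
      have := (ZMod.intCast_zmod_eq_zero_iff_dvd 2 p).mp (by exact_mod_cast h)
      exact_mod_cast this
    exact this.trans (dvd_mul_right 2 d)
  have hE : (cm16Model d).map (Int.castRingHom (ZMod p)) = ⟨0, -6 * (d : ZMod p), 0, (d : ZMod p) ^ 2, 0⟩ :=
    map_cm16Model d _
  haveI : (⟨0, -6 * (d : ZMod p), 0, (d : ZMod p) ^ 2, 0⟩ : WeierstrassCurve (ZMod p)).IsElliptic :=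
    hE ▸ isElliptic_cm16Model_zmod hpd
  have hF : (cm16Codomain d).map (Int.castRingHom (ZMod p)) =
      (⟨Units.mk0 2 h2, 0, 0, 0⟩ : VariableChange (ZMod p)) •
        ⟨0, -2 * (-6 * (d : ZMod p)), 0, (-6 * (d : ZMod p)) ^ 2 - 4 * (d : ZMod p) ^ 2, 0⟩ := by
    rw [map_cm16Codomain]
    ext
    · simp [variableChange_a₁]
    · simp only [variableChange_a₂, Units.val_inv_eq_inv_val, Units.val_mk0]
      field_simp
      ring
    · simp [variableChange_a₃]
    · simp only [variableChange_a₄, Units.val_inv_eq_inv_val, Units.val_mk0]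
      field_simp
      ring
    · simp [variableChange_a₆]
  rw [hE, hF, natCard_point_smul]
  exact natCard_point_twoTorsionNF_eq _ _

end Good

/-! ## Assembly: equal local polynomials everywhere, equal `L`-functions -/

section Assembly

variable {d : ℤ}

/-- **The local polynomials of `E_d` and `E'_d` agree at every finite place of `ℚ`**
(`d ≠ 0` squarefree). [cite: Knapp1993, proof of Thm. 11.67 (PDF pp. 281–282)] -/
theorem localPolynomial_cm16_eq (hd : d ≠ 0) (hsq : Squarefree d) (v : HeightOneSpectrum (𝓞 ℚ)) :
    (((cm16Model d).map (Int.castRingHom ℚ)).baseChange (v.adicCompletion ℚ)).localPolynomial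
        (v.adicCompletionIntegers ℚ) =
      (((cm16Codomain d).map (Int.castRingHom ℚ)).baseChange (v.adicCompletion ℚ)).localPolynomial
        (v.adicCompletionIntegers ℚ) := by
  by_cases hv : (natGenerator v : ℤ) ∣ 2 * d
  · exact localPolynomial_eq_of_hasAdditiveReductionAt v
      (hasAdditiveReductionAt_cm16Model v hsq hv) (hasAdditiveReductionAt_cm16Codomain v hd hsq hv)
  · haveI := Fact.mk (prime_natGenerator v)
    have hpZ := Rat.prime_natGenerator_int v
    have hdvd : ∀ k : ℕ, ¬ (natGenerator v : ℤ) ∣ 2 ^ k * d ^ 6 := fun k h ↦ by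
      rcases hpZ.dvd_or_dvd h with h | h
      · exact hv ((hpZ.dvd_of_dvd_pow h).trans (dvd_mul_right 2 d))
      · exact hv ((hpZ.dvd_of_dvd_pow h).mul_left 2)
    refine localPolynomial_map_eq_of_natCard_eq v _ _ ?_ ?_ (natCard_point_cm16_zmod_eq hv)
    · rw [cm16Model_Δ]; exact hdvd 9
    · rw [cm16Codomain_Δ]; exact hdvd 6

/-- **`L(E_d, s) = L(E'_d, s)`** for the `2`-isogenous CM curves `E_d = [0, -6d, 0, d², 0]`
(`j = 287496`) and `E'_d = [0, 3d, 0, 2d², 0]` (`j = 1728`), every squarefree `d ≠ 0`: the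
instance of Knapp's Theorem 11.67 for this isogeny class, proved prime by prime for Mathlib's
`WeierstrassCurve.LFunction`. [cite: Knapp1993, Thm. 11.67 (PDF p. 281)] -/
theorem LFunction_cm16_eq (hd : d ≠ 0) (hsq : Squarefree d) :
    ((cm16Model d).map (Int.castRingHom ℚ)).LFunction =
      ((cm16Codomain d).map (Int.castRingHom ℚ)).LFunction :=
  LFunction_eq_of_forall_localPolynomial_eq (localPolynomial_cm16_eq hd hsq)

/-- `E_d ~ E'_d` over `ℚ` (Silverman III.4.5: `E'_d = ⟨2, 0, 0, 0⟩ • (2-isogeny codomain of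
E_d)`). [cite: SilvermanAEC2009, III.4 Example 4.5] -/
theorem isIsogenous_cm16Model (hd : d ≠ 0) :
    IsIsogenous ((cm16Model d).map (Int.castRingHom ℚ)) ((cm16Codomain d).map (Int.castRingHom ℚ)) := by
  have hE : (cm16Model d).map (Int.castRingHom ℚ) = ⟨0, -6 * (d : ℚ), 0, (d : ℚ) ^ 2, 0⟩ :=
    map_cm16Model d _
  haveI : (⟨0, -6 * (d : ℚ), 0, (d : ℚ) ^ 2, 0⟩ : WeierstrassCurve ℚ).IsElliptic := by
    refine ⟨isUnit_iff_ne_zero.mpr ?_⟩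
    have := congrArg (fun W : WeierstrassCurve ℤ ↦ (W.map (Int.castRingHom ℚ)).Δ) (rfl : cm16Model d = _)
    rw [← hE, map_Δ, cm16Model_Δ]
    simp only [map_mul, map_pow, eq_intCast, Int.cast_ofNat]
    exact mul_ne_zero (by norm_num) (pow_ne_zero _ (Int.cast_ne_zero.mpr hd))
  have hF : (cm16Codomain d).map (Int.castRingHom ℚ) =
      (⟨Units.mk0 2 two_ne_zero, 0, 0, 0⟩ : VariableChange ℚ) •
        (⟨0, -6 * (d : ℚ), 0, (d : ℚ) ^ 2, 0⟩ : WeierstrassCurve ℚ).twoIsogenyCodomain := by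
    rw [map_cm16Codomain]
    ext
    · simp [variableChange_a₁, twoIsogenyCodomain]
    · simp only [variableChange_a₂, twoIsogenyCodomain, Units.val_inv_eq_inv_val, Units.val_mk0]
      field_simp
      ring
    · simp [variableChange_a₃, twoIsogenyCodomain]
    · simp only [variableChange_a₄, twoIsogenyCodomain, Units.val_inv_eq_inv_val, Units.val_mk0]
      field_simp
      ring
    · simp [variableChange_a₆, twoIsogenyCodomain]
  rw [hE, hF]
  exact IsIsogenous.trans' (isIsogenous_twoIsogenyCodomain _) (isIsogenous_smul _ _)

/-- **Knapp 11.67 for the class `j = 287496 ~ 1728`, in the form consumed by the CM reductions**: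
`E_d` and `E'_d` are isogenous over `ℚ` *and* have the same `L`-function. [cite: Knapp1993, Thm. 11.67] -/
theorem isIsogenous_and_LFunction_eq_cm16 (hd : d ≠ 0) (hsq : Squarefree d) :
    IsIsogenous ((cm16Model d).map (Int.castRingHom ℚ)) ((cm16Codomain d).map (Int.castRingHom ℚ)) ∧
      ((cm16Model d).map (Int.castRingHom ℚ)).LFunction =
        ((cm16Codomain d).map (Int.castRingHom ℚ)).LFunction :=
  ⟨isIsogenous_cm16Model hd, LFunction_cm16_eq hd hsq⟩

end Assembly

end WeierstrassCurve
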